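import Literature.Probability.RandomPlanarGeometry.SAWLoopErasureSrwNeighbourCounts
import Literature.Probability.RandomPlanarGeometry.SAWLoopErasureKestenRenewalGreenChernoff
import Literature.Probability.FitznerVanDerHofstad2017.SrwFarNodeBound
import Literature.Probability.FitznerVanDerHofstad2017.SrwSeedCertSemantics
import HarnessLib

/-!
# Green-function enclosures at the sites `|x|₁ ≤ 3`, symbolic in the dimension (`d ≥ 22`)

Topic `Literature/Probability/RandomPlanarGeometry` (Hara–Slade–Sokal loop-erasure lane, door D1: the inputs of the `(2̃,1)`
bootstrap of HSS93 §3.2 with REMAINDERS `O(d⁻⁶)` UNIFORM in `d ≥ 22`, so that the floor `μ(ℤ^d) ≥ 2d − 1 − 1/(2d) −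
3/(4d²) − 9/(4d³) − C/d⁴` can be assembled for all large `d` at once instead of one certified decimal table per dimension).
For `G(x) = C₀(0,x;1/2d) = srwI d 1 0 x = Σ_n p_n(x)`:

* §0 parity/support vanishing `p_m(x) = 0` unless `m ≡ |x|₁ (mod 2)`, `m ≥ |x|₁` (from `SeedCert.G_eq_zero_of_not_support`),
  and the coordinate lists of the seven classes `0, e₁, 2e₁, e₁+e₂, 3e₁, 2e₁+e₂, e₁+e₂+e₃`;
* §1 the Chernoff majorants `p_{2m}(0) ≤ c̄_m/d^m` for `13 ≤ m ≤ 16` (extending `GreenChernoff.chernoffCoeff`, `m ≤ 12`);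
* §2 the ORIGIN TAIL `G(0) − Σ_{m<M₀} p_{2m}(0) ≤ T_{M₀}/d⁶` for `d ≥ 22`, `7 ≤ M₀ ≤ 16`
  (Chernoff head `m < 16`, antitone block `16 ≤ m ≤ d²` at `p₃₂(0) ≤ c̄₁₆/d¹⁶`, far tail `800/5^d ≤ (1/25000)/d⁶`), with the
  numerical instances `T₇ = 1072`, `T₈ = 750`, `T₉ = 633`;
* §3 the origin: `H₀(d) ≤ G(0) ≤ H₀(d) + 633/d⁶`, `H₀(d) = Σ_{m ≤ 16} p_m(0) = Σ_{m≤8} u_{2m}(d)/(2d)^{2m}` in closed form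
  (`SAWLoopErasureSrwOriginCounts`);
* §4–§9 the six off-origin classes: `H_x(d) ≤ G(x) ≤ H_x(d) + T/d⁶` (`T = 1072` for `|x|₁ = 2`, `T = 750` for `|x|₁ ∈ {1,3}`) with `H_x(d) = Σ_{m ≤
12 or 13} p_m(x)` in closed form
  (`SAWLoopErasureSrwNeighbourCounts`), via `G(x) = Σ_{i<N} p_i(x) + I_{1,N}(x)`, `0 ≤ I_{1,N}(x) ≤ I_{1,N}(0) = G(0) − Σ_{i<N} p_i(0)`
  (`srwI_one_eq_sum_add`, `srwI_nonneg`, `srwI_one_le_sum_add_zero`, `srwI_one_shift_zero_eq`).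

In `s = 1/(2d)`: `H₀ = 1 + s + 3s² + 12s³ + 60s⁴ + 355s⁵ + …`, `H_{e₁} = H₀ − 1 + O(s⁷)`, `H_{2e₁} = s² + 6s³ + 37s⁴ + …`,
`H_{e₁+e₂} = 2s² + 12s³ + 66s⁴ + …`, `H_{3e₁} = s³ + 10s⁴ + …`, `H_{2e₁+e₂} = 3s³ + 30s⁴ + …`, `H_{e₁+e₂+e₃} = 6s³ + 60s⁴ + …`
(HSS93 (A.7)).  Sites are specified by coordinate hypotheses (`coordD x 0 = 2`, `coordD x i = 0` for `i ≥ 1`, …); the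
transport to `a • stepVec t + …` is the axis-symmetry module `SAWLoopErasureMemoryTwoAxisSymmetry` (not restated).

References: [HSS93] T. Hara, G. Slade, A. D. Sokal, J. Stat. Phys. 72 (1993) 479–517, arXiv:hep-lat/9302003, §3.2
(3.13)–(3.14), Appendix A.1 (A.7) pp. 27–30, Table 4; tree: `GreenChernoff.srwLaw_two_mul_zero_le_chernoff`, `GreenChernoff.tsum_far_le`,
`GreenCert.hasSum_srwLaw_two_mul_zero`, `SrwFarNodeBound`.
Edition ed.1b: the numerics helper `exp_one_le_d9` is `private` (it restates `GreenChernoff`'s private `exp_one_le_rat`).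
-/

namespace Literature.Probability.RandomPlanarGeometry.SAW.Zd.LoopErasure

open Finset
open scoped Nat
open Literature.Barriers.CriticalPhenomena.LongRangePhi4 (srwLaw srwLaw_nonneg srwLaw_zero_apply
  srwLaw_two_mul_zero_antitone)
open Literature.Probability.FitznerVanDerHofstad2017
open Literature.Probability.FitznerVanDerHofstad2017.SrwCount (coordD G srwCount srwLaw_eq_srwCount_div)
open Literature.Probability.FitznerVanDerHofstad2017.SeedCert (Asum G_eq_zero_of_not_support)
open Literature.Probability.LatticeModels.SRW (stepVec stepVec_apply)
open GreenChernoff (chernoffCoeff srwLaw_two_mul_zero_le_chernoff srwLaw_two_mul_zero_le_coeff tsum_far_le)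

variable {d : ℕ}

namespace GreenSymbolic

/-! ### §0 Parity/support vanishing and the coordinate lists of the classes -/

/-- `A_j(cs) = Σ cs` once `j ≥ |cs|`. [cite: HaraSladeSokal1993, Appendix A.1 pp. 27–30 (1/d expansion of C₀(0,x;1/2d)); lane plumbing] -/
theorem Asum_of_length_le {cs : List ℕ} {j : ℕ} (hj : cs.length ≤ j) : Asum cs j = cs.sum := by
  simp [Asum, List.take_of_length_le hj]

/-- **Support of the `m`-step law**: for a site with coordinate list `cs` (`x_i = cs_i`, zero-padded, `|cs| ≤ d`),
`p_m(x) = 0` unless `m = 2i + Σ cs` for some `i`. [cite: HaraSladeSokal1993, Appendix A.1 pp. 27–30 (1/d expansion of C₀(0,x;1/2d)); lane plumbing] -/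
theorem srwLaw_eq_zero_of_coordList {x : Fin d → ℤ} (cs : List ℕ)
    (hcs : ∀ i, coordD x i = ((cs.getD i 0 : ℕ) : ℤ)) (hd : cs.length ≤ d) {m : ℕ}
    (h : ∀ i, m ≠ 2 * i + cs.sum) : srwLaw d m x = 0 := by
  rw [srwLaw_eq_srwCount_div, show srwCount d m x = G x d m from rfl,
    G_eq_zero_of_not_support hcs d m (fun i => by rw [Asum_of_length_le hd]; exact h i), Nat.cast_zero, zero_div]

/-- The origin has coordinate list `[]`. [cite: HaraSladeSokal1993, Appendix A.1 pp. 27–30 (1/d expansion of C₀(0,x;1/2d)); lane plumbing] -/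
theorem coordList_origin : ∀ i, coordD (0 : Fin d → ℤ) i = ((([] : List ℕ).getD i 0 : ℕ) : ℤ) := fun i => by
  simp [SrwDimRec.coordD_origin]

/-- **`p_{2m+1}(0) = 0`**. [cite: HaraSladeSokal1993, Appendix A.1 pp. 27–30 (1/d expansion of C₀(0,x;1/2d)); lane plumbing] -/
theorem srwLaw_odd_origin (d m : ℕ) : srwLaw d (2 * m + 1) (0 : Fin d → ℤ) = 0 :=
  srwLaw_eq_zero_of_coordList [] coordList_origin (by simp) fun i => by simp only [List.sum_nil]; omega

/-- The class of `e₁` has coordinate list `[1]`. [cite: HaraSladeSokal1993, Appendix A.1 pp. 27–30 (1/d expansion of C₀(0,x;1/2d)); lane plumbing] -/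
theorem coordList_axisOne {x : Fin d → ℤ} (h0 : coordD x 0 = 1) (hz : ∀ i, 1 ≤ i → coordD x i = 0) :
    ∀ i, coordD x i = ((([1] : List ℕ).getD i 0 : ℕ) : ℤ) := by
  intro i
  rcases i with _ | i
  · simpa using h0
  · simpa using hz (i + 1) (by omega)

/-- **`p_m(x) = 0` for even `m`** at the class of `e₁` (`d ≥ 1`). [cite: HaraSladeSokal1993, Appendix A.1 pp. 27–30 (1/d expansion of C₀(0,x;1/2d));
lane plumbing] -/
theorem srwLaw_axisOne_even {x : Fin d → ℤ} (hd : 1 ≤ d) (h0 : coordD x 0 = 1) (hz : ∀ i, 1 ≤ i → coordD x i = 0) (m : ℕ) :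
    srwLaw d (2 * m) x = 0 :=
  srwLaw_eq_zero_of_coordList [1] (coordList_axisOne h0 hz) (by simpa using hd) fun i => by
    simp only [List.sum_cons, List.sum_nil]; omega

/-- The class of `2e₁` has coordinate list `[2]`. [cite: HaraSladeSokal1993, Appendix A.1 pp. 27–30 (1/d expansion of C₀(0,x;1/2d)); lane plumbing] -/
theorem coordList_axisTwo {x : Fin d → ℤ} (h0 : coordD x 0 = 2) (hz : ∀ i, 1 ≤ i → coordD x i = 0) :
    ∀ i, coordD x i = ((([2] : List ℕ).getD i 0 : ℕ) : ℤ) := by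
  intro i
  rcases i with _ | i
  · simpa using h0
  · simpa using hz (i + 1) (by omega)

/-- **`p_m(x) = 0` for odd `m`** at the class of `2e₁` (`d ≥ 1`). [cite: HaraSladeSokal1993, Appendix A.1 pp. 27–30 (1/d expansion of C₀(0,x;1/2d));
lane plumbing] -/
theorem srwLaw_axisTwo_odd {x : Fin d → ℤ} (hd : 1 ≤ d) (h0 : coordD x 0 = 2) (hz : ∀ i, 1 ≤ i → coordD x i = 0) (m : ℕ) :
    srwLaw d (2 * m + 1) x = 0 :=
  srwLaw_eq_zero_of_coordList [2] (coordList_axisTwo h0 hz) (by simpa using hd) fun i => by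
    simp only [List.sum_cons, List.sum_nil]; omega

/-- The class of `e₁+e₂` has coordinate list `[1, 1]`. [cite: HaraSladeSokal1993, Appendix A.1 pp. 27–30 (1/d expansion of C₀(0,x;1/2d)); lane
plumbing] -/
theorem coordList_pair {x : Fin d → ℤ} (h0 : coordD x 0 = 1) (h1 : coordD x 1 = 1) (hz : ∀ i, 2 ≤ i → coordD x i = 0) :
    ∀ i, coordD x i = ((([1, 1] : List ℕ).getD i 0 : ℕ) : ℤ) := by
  intro i
  rcases i with _ | _ | i
  · simpa using h0
  · simpa using h1
  · simpa using hz (i + 2) (by omega)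

/-- **`p_m(x) = 0` for odd `m`** at the class of `e₁+e₂` (`d ≥ 2`). [cite: HaraSladeSokal1993, Appendix A.1 pp. 27–30 (1/d expansion of
C₀(0,x;1/2d)); lane plumbing] -/
theorem srwLaw_pair_odd {x : Fin d → ℤ} (hd : 2 ≤ d) (h0 : coordD x 0 = 1) (h1 : coordD x 1 = 1) (hz : ∀ i, 2 ≤ i → coordD x i = 0) (m : ℕ) :
    srwLaw d (2 * m + 1) x = 0 :=
  srwLaw_eq_zero_of_coordList [1, 1] (coordList_pair h0 h1 hz) (by simpa using hd) fun i => by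
    simp only [List.sum_cons, List.sum_nil]; omega

/-- The class of `3e₁` has coordinate list `[3]`. [cite: HaraSladeSokal1993, Appendix A.1 pp. 27–30 (1/d expansion of C₀(0,x;1/2d)); lane plumbing] -/
theorem coordList_axisThree {x : Fin d → ℤ} (h0 : coordD x 0 = 3) (hz : ∀ i, 1 ≤ i → coordD x i = 0) :
    ∀ i, coordD x i = ((([3] : List ℕ).getD i 0 : ℕ) : ℤ) := by
  intro i
  rcases i with _ | i
  · simpa using h0
  · simpa using hz (i + 1) (by omega)

/-- **`p_m(x) = 0` for even `m`** at the class of `3e₁` (`d ≥ 1`). [cite: HaraSladeSokal1993, Appendix A.1 pp. 27–30 (1/d expansion of C₀(0,x;1/2d));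
lane plumbing] -/
theorem srwLaw_axisThree_even {x : Fin d → ℤ} (hd : 1 ≤ d) (h0 : coordD x 0 = 3) (hz : ∀ i, 1 ≤ i → coordD x i = 0) (m : ℕ) :
    srwLaw d (2 * m) x = 0 :=
  srwLaw_eq_zero_of_coordList [3] (coordList_axisThree h0 hz) (by simpa using hd) fun i => by
    simp only [List.sum_cons, List.sum_nil]; omega

/-- The class of `2e₁+e₂` has coordinate list `[2, 1]`. [cite: HaraSladeSokal1993, Appendix A.1 pp. 27–30 (1/d expansion of C₀(0,x;1/2d)); lane
plumbing] -/
theorem coordList_axisTwoOne {x : Fin d → ℤ} (h0 : coordD x 0 = 2) (h1 : coordD x 1 = 1) (hz : ∀ i, 2 ≤ i → coordD x i = 0) :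
    ∀ i, coordD x i = ((([2, 1] : List ℕ).getD i 0 : ℕ) : ℤ) := by
  intro i
  rcases i with _ | _ | i
  · simpa using h0
  · simpa using h1
  · simpa using hz (i + 2) (by omega)

/-- **`p_m(x) = 0` for even `m`** at the class of `2e₁+e₂` (`d ≥ 2`). [cite: HaraSladeSokal1993, Appendix A.1 pp. 27–30 (1/d expansion of
C₀(0,x;1/2d)); lane plumbing] -/
theorem srwLaw_axisTwoOne_even {x : Fin d → ℤ} (hd : 2 ≤ d) (h0 : coordD x 0 = 2) (h1 : coordD x 1 = 1) (hz : ∀ i, 2 ≤ i → coordD x i = 0) (m : ℕ) :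
    srwLaw d (2 * m) x = 0 :=
  srwLaw_eq_zero_of_coordList [2, 1] (coordList_axisTwoOne h0 h1 hz) (by simpa using hd) fun i => by
    simp only [List.sum_cons, List.sum_nil]; omega

/-- The class of `e₁+e₂+e₃` has coordinate list `[1, 1, 1]`. [cite: HaraSladeSokal1993, Appendix A.1 pp. 27–30 (1/d expansion of C₀(0,x;1/2d)); lane
plumbing] -/
theorem coordList_triple {x : Fin d → ℤ} (h0 : coordD x 0 = 1) (h1 : coordD x 1 = 1) (h2 : coordD x 2 = 1) (hz : ∀ i, 3 ≤ i → coordD x i = 0) :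
    ∀ i, coordD x i = ((([1, 1, 1] : List ℕ).getD i 0 : ℕ) : ℤ) := by
  intro i
  rcases i with _ | _ | _ | i
  · simpa using h0
  · simpa using h1
  · simpa using h2
  · simpa using hz (i + 3) (by omega)

/-- **`p_m(x) = 0` for even `m`** at the class of `e₁+e₂+e₃` (`d ≥ 3`). [cite: HaraSladeSokal1993, Appendix A.1 pp. 27–30 (1/d expansion of
C₀(0,x;1/2d)); lane plumbing] -/
theorem srwLaw_triple_even {x : Fin d → ℤ} (hd : 3 ≤ d) (h0 : coordD x 0 = 1) (h1 : coordD x 1 = 1) (h2 : coordD x 2 = 1) (hz : ∀ i, 3 ≤ i →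
    coordD x i = 0) (m : ℕ) :
    srwLaw d (2 * m) x = 0 :=
  srwLaw_eq_zero_of_coordList [1, 1, 1] (coordList_triple h0 h1 h2 hz) (by simpa using hd) fun i => by
    simp only [List.sum_cons, List.sum_nil]; omega

/-! ### §1 Chernoff majorants `p_{2m}(0) ≤ c̄_m/d^m`, `13 ≤ m ≤ 16` -/

/-- Rational majorants `c̄_m ≥ (2m)!·e^m/(4m)^m`, `13 ≤ m ≤ 16` (`0` elsewhere), extending `GreenChernoff.chernoffCoeff`
(`3 ≤ m ≤ 12`). [cite: HaraSladeSokal1993, Appendix A.1 pp. 28–30 and Table 4 (C₀(0,0;1/2d) = G_d, via the Bessel representation); lane certificate]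
-/
def chernoffCoeffHigh : ℕ → ℚ
  | 13 => 8787000000
  | 14 => 123046000000
  | 15 => 1846047000000
  | 16 => 29541868000000
  | _ => 0

/-- `e ≤ 2.718281829` (Mathlib's `Real.exp_one_lt_d9`). [cite: HaraSladeSokal1993, Appendix A.1 pp. 27–30 (1/d expansion of C₀(0,x;1/2d)); lane
plumbing] -/
private theorem exp_one_le_d9 : Real.exp 1 ≤ (2718281829 / 1000000000 : ℝ) :=
  (Real.exp_one_lt_d9.trans (by norm_num)).le

/-- `(2m)!·e^m/(4dm)^m ≤ c̄_m/d^m` for `13 ≤ m ≤ 16`, `d ≥ 1`. [cite: HaraSladeSokal1993, Appendix A.1 pp. 27–30 (1/d expansion of C₀(0,x;1/2d));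
lane plumbing] -/
theorem chernoff_le_coeffHigh_div_pow (hd : 1 ≤ d) {m : ℕ} (h13 : 13 ≤ m) (h16 : m ≤ 16) :
    ((2 * m)! : ℝ) * Real.exp m / (4 * d * m : ℝ) ^ m ≤ (chernoffCoeffHigh m : ℝ) / (d : ℝ) ^ m := by
  have hd0 : (0 : ℝ) < d := by exact_mod_cast hd
  have hm0 : (0 : ℝ) < m := by exact_mod_cast (show 0 < m by omega)
  have hexp : Real.exp m ≤ (2718281829 / 1000000000 : ℝ) ^ m := by
    rw [show (m : ℝ) = m * 1 by ring, Real.exp_nat_mul]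
    exact pow_le_pow_left₀ (Real.exp_pos 1).le exp_one_le_d9 m
  have hkey : ((2 * m)! : ℝ) * Real.exp m ≤ (chernoffCoeffHigh m : ℝ) * (4 * m : ℝ) ^ m := by
    have hmpos : (0 : ℝ) < Real.exp m := Real.exp_pos _
    interval_cases m <;> norm_num [chernoffCoeffHigh, Nat.factorial] at hexp ⊢ <;> nlinarith [hexp, hmpos]
  have hdm : (0 : ℝ) < (d : ℝ) ^ m := by positivity
  have h4m : (0 : ℝ) < (4 * m : ℝ) ^ m := by positivity
  rw [show (4 * d * m : ℝ) ^ m = (4 * m : ℝ) ^ m * (d : ℝ) ^ m by rw [← mul_pow]; ring_nf,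
    div_le_div_iff₀ (by positivity) hdm]
  calc ((2 * m)! : ℝ) * Real.exp m * (d : ℝ) ^ m
      ≤ (chernoffCoeffHigh m : ℝ) * (4 * m : ℝ) ^ m * (d : ℝ) ^ m := mul_le_mul_of_nonneg_right hkey hdm.le
    _ = (chernoffCoeffHigh m : ℝ) * ((4 * m : ℝ) ^ m * (d : ℝ) ^ m) := by ring

/-- **`p_{2m}(0) ≤ c̄_m/d^m` for `13 ≤ m ≤ 16`**, `d ≥ 1`. [cite: HaraSladeSokal1993, Appendix A.1 pp. 28–30 and Table 4 (C₀(0,0;1/2d) = G_d, via the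
Bessel representation); lane certificate] -/
theorem srwLaw_two_mul_zero_le_coeffHigh (hd : 1 ≤ d) {m : ℕ} (h13 : 13 ≤ m) (h16 : m ≤ 16) :
    srwLaw d (2 * m) 0 ≤ (chernoffCoeffHigh m : ℝ) / (d : ℝ) ^ m :=
  (srwLaw_two_mul_zero_le_chernoff hd m).trans (chernoff_le_coeffHigh_div_pow hd h13 h16)

/-- The merged coefficient table `c̄_m`, `3 ≤ m ≤ 16`. [cite: HaraSladeSokal1993, Appendix A.1 pp. 27–30 (1/d expansion of C₀(0,x;1/2d)); lane
plumbing] -/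
def coeffAll (m : ℕ) : ℚ := if m ≤ 12 then chernoffCoeff m else chernoffCoeffHigh m

/-- `0 ≤ c̄_m`. [cite: HaraSladeSokal1993, Appendix A.1 pp. 27–30 (1/d expansion of C₀(0,x;1/2d)); lane plumbing] -/
theorem coeffAll_nonneg (m : ℕ) : (0 : ℝ) ≤ (coeffAll m : ℝ) := by
  unfold coeffAll chernoffCoeff chernoffCoeffHigh
  split_ifs <;> (split <;> norm_num)

/-- **`p_{2m}(0) ≤ c̄_m/d^m` for `3 ≤ m ≤ 16`**, `d ≥ 1`. [cite: HaraSladeSokal1993, Appendix A.1 pp. 28–30 and Table 4 (C₀(0,0;1/2d) = G_d, via the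
Bessel representation); lane certificate] -/
theorem srwLaw_two_mul_zero_le_coeffAll (hd : 1 ≤ d) {m : ℕ} (h3 : 3 ≤ m) (h16 : m ≤ 16) :
    srwLaw d (2 * m) 0 ≤ (coeffAll m : ℝ) / (d : ℝ) ^ m := by
  unfold coeffAll
  split_ifs with h
  · exact srwLaw_two_mul_zero_le_coeff hd h3 h
  · exact srwLaw_two_mul_zero_le_coeffHigh hd (by omega) h16

/-! ### §2 The origin tail `G(0) − Σ_{m<M₀} p_{2m}(0) ≤ T_{M₀}/d⁶` (`d ≥ 22`) -/

/-- `c/d^k ≤ (c/22^{k−6})/d⁶` for `d ≥ 22`, `k ≥ 6`, `c ≥ 0`. [cite: HaraSladeSokal1993, Appendix A.1 pp. 27–30 (1/d expansion of C₀(0,x;1/2d)); lane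
plumbing] -/
theorem div_pow_le_div_pow_six (hd : 22 ≤ d) {k : ℕ} (hk : 6 ≤ k) {c : ℝ} (hc : 0 ≤ c) :
    c / (d : ℝ) ^ k ≤ c / 22 ^ (k - 6) / (d : ℝ) ^ 6 := by
  have hd0 : (0 : ℝ) < d := by exact_mod_cast (show 0 < d by omega)
  have hd22 : (22 : ℝ) ≤ d := by exact_mod_cast hd
  rw [div_div]
  refine div_le_div_of_nonneg_left hc (by positivity) ?_
  obtain ⟨e, rfl⟩ : ∃ e, k = e + 6 := ⟨k - 6, by omega⟩
  rw [Nat.add_sub_cancel, pow_add, mul_comm, mul_comm ((d : ℝ) ^ e)]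
  exact mul_le_mul_of_nonneg_left (pow_le_pow_left₀ (by norm_num) hd22 e) (by positivity)

/-- `2·10⁷·d⁶ ≤ 5^d` for `d ≥ 22`. [cite: HaraSladeSokal1993, Appendix A.1 pp. 27–30 (1/d expansion of C₀(0,x;1/2d)); lane plumbing] -/
theorem mul_pow_six_le_five_pow (hd : 22 ≤ d) : (20000000 : ℝ) * (d : ℝ) ^ 6 ≤ 5 ^ d := by
  induction d, hd using Nat.le_induction with
  | base => norm_num
  | succ n hn ih =>
      have hn' : (22 : ℝ) ≤ n := by exact_mod_cast hn
      have hn0 : (0 : ℝ) ≤ n := by linarith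
      have h23 : (n : ℝ) + 1 ≤ 23 / 22 * n := by linarith
      have h1 : ((n : ℝ) + 1) ^ 6 ≤ (23 / 22 * n) ^ 6 := pow_le_pow_left₀ (by linarith) h23 6
      push_cast
      rw [pow_succ (5 : ℝ) n]
      nlinarith [h1, pow_nonneg hn0 6, pow_nonneg (show (0 : ℝ) ≤ 5 by norm_num) n]

/-- Far tail in the `d⁻⁶` currency: `800/5^d ≤ (1/25000)/d⁶` for `d ≥ 22`. [cite: HaraSladeSokal1993, Appendix A.1 pp. 27–30 (1/d expansion of
C₀(0,x;1/2d)); lane plumbing] -/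
theorem far_le_div_pow_six (hd : 22 ≤ d) : (800 : ℝ) / 5 ^ d ≤ 1 / 25000 / (d : ℝ) ^ 6 := by
  have hd0 : (0 : ℝ) < d := by exact_mod_cast (show 0 < d by omega)
  have h := mul_pow_six_le_five_pow hd
  have h5 : (0 : ℝ) < 5 ^ d := by positivity
  rw [div_div, div_le_div_iff₀ h5 (by positivity)]
  nlinarith [h, pow_pos hd0 6]

/-- The tail constant `T_{M₀} = Σ_{M₀ ≤ m < 16} c̄_m/22^{m−6} + c̄₁₆/22⁸ + 1/25000`. [cite: HaraSladeSokal1993, Appendix A.1 pp. 27–30 (1/d expansion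
of C₀(0,x;1/2d)); lane plumbing] -/
def greenTailConst (M₀ : ℕ) : ℚ := (∑ m ∈ Ico M₀ 16, coeffAll m / 22 ^ (m - 6)) + coeffAll 16 / 22 ^ 8 + 1 / 25000

/-- **Origin tail, symbolic in `d`**: `G(0) − Σ_{m<M₀} p_{2m}(0) ≤ T_{M₀}/d⁶` for `d ≥ 22`, `6 ≤ M₀ ≤ 16`
(Chernoff head, antitone block `16 ≤ m ≤ d²` bounded by `d²·p₃₂(0) ≤ c̄₁₆/d¹⁴`, far tail `Σ_{m>d²} ≤ 800/5^d`). [cite: HaraSladeSokal1993, Appendix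
A.1 pp. 28–30 and Table 4 (C₀(0,0;1/2d) = G_d, via the Bessel representation); lane certificate] -/
theorem srwI_one_zero_sub_sum_le (hd : 22 ≤ d) {M₀ : ℕ} (h6 : 6 ≤ M₀) (h16 : M₀ ≤ 16) :
    srwI d 1 0 0 - ∑ m ∈ range M₀, srwLaw d (2 * m) 0 ≤ (greenTailConst M₀ : ℝ) / (d : ℝ) ^ 6 := by
  have hd1 : 1 ≤ d := by omega
  have hd3 : 3 ≤ d := by omega
  have hd0 : (0 : ℝ) < d := by exact_mod_cast (show 0 < d by omega)
  have hd22 : (22 : ℝ) ≤ d := by exact_mod_cast hd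
  have h := GreenCert.hasSum_srwLaw_two_mul_zero hd3
  have hsplit := h.summable.sum_add_tsum_nat_add (d ^ 2 + 1)
  rw [h.tsum_eq] at hsplit
  have hs' : Summable fun j => srwLaw d (2 * (j + (d ^ 2 + 1))) 0 :=
    (summable_nat_add_iff (f := fun m => srwLaw d (2 * m) 0) (d ^ 2 + 1)).2 h.summable
  have hfar := (tsum_far_le (by omega) hs').trans (far_le_div_pow_six hd)
  have hM : M₀ ≤ 16 := h16
  have h16' : 16 ≤ d ^ 2 + 1 := by nlinarith
  rw [← sum_range_add_sum_Ico _ (hM.trans h16'), ← sum_Ico_consecutive _ hM h16'] at hsplit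
  have hhead : ∑ m ∈ Ico M₀ 16, srwLaw d (2 * m) 0 ≤
      ∑ m ∈ Ico M₀ 16, (coeffAll m : ℝ) / 22 ^ (m - 6) / (d : ℝ) ^ 6 := by
    refine sum_le_sum fun m hm => ?_
    rw [mem_Ico] at hm
    exact (srwLaw_two_mul_zero_le_coeffAll hd1 (by omega) (by omega)).trans
      (div_pow_le_div_pow_six hd (by omega) (coeffAll_nonneg m))
  have hblock : ∑ m ∈ Ico 16 (d ^ 2 + 1), srwLaw d (2 * m) 0 ≤ (coeffAll 16 : ℝ) / 22 ^ 8 / (d : ℝ) ^ 6 := by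
    have h16c : srwLaw d (2 * 16) 0 ≤ (coeffAll 16 : ℝ) / (d : ℝ) ^ 16 :=
      srwLaw_two_mul_zero_le_coeffAll hd1 (by norm_num) le_rfl
    have hanti : ∀ m ∈ Ico 16 (d ^ 2 + 1), srwLaw d (2 * m) 0 ≤ srwLaw d (2 * 16) 0 := fun m hm =>
      srwLaw_two_mul_zero_antitone hd1 (mem_Ico.1 hm).1
    refine (sum_le_card_nsmul _ _ _ hanti).trans ?_
    rw [Nat.card_Ico, nsmul_eq_mul]
    have hcard : ((d ^ 2 + 1 - 16 : ℕ) : ℝ) ≤ (d : ℝ) ^ 2 := by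
      have : d ^ 2 + 1 - 16 ≤ d ^ 2 := by omega
      exact_mod_cast this
    have hq0 : 0 ≤ srwLaw d (2 * 16) 0 := srwLaw_nonneg _ _
    calc ((d ^ 2 + 1 - 16 : ℕ) : ℝ) * srwLaw d (2 * 16) 0
        ≤ (d : ℝ) ^ 2 * ((coeffAll 16 : ℝ) / (d : ℝ) ^ 16) := mul_le_mul hcard h16c hq0 (by positivity)
      _ = (coeffAll 16 : ℝ) / (d : ℝ) ^ 14 := by field_simp
      _ ≤ (coeffAll 16 : ℝ) / 22 ^ (14 - 6) / (d : ℝ) ^ 6 :=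
          div_pow_le_div_pow_six hd (by norm_num) (coeffAll_nonneg 16)
      _ = (coeffAll 16 : ℝ) / 22 ^ 8 / (d : ℝ) ^ 6 := rfl
  have htail : (greenTailConst M₀ : ℝ) / (d : ℝ) ^ 6 = (∑ m ∈ Ico M₀ 16, (coeffAll m : ℝ) / 22 ^ (m - 6) / (d : ℝ) ^ 6) +
      (coeffAll 16 : ℝ) / 22 ^ 8 / (d : ℝ) ^ 6 + 1 / 25000 / (d : ℝ) ^ 6 := by
    rw [← Finset.sum_div, ← add_div, ← add_div]
    push_cast [greenTailConst]
    ring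
  rw [htail]
  linarith

/-- `T₇ ≤ 1072`. [cite: HaraSladeSokal1993, Appendix A.1 pp. 27–30 (1/d expansion of C₀(0,x;1/2d)); lane plumbing] -/
theorem greenTailConst_seven_le : (greenTailConst 7 : ℝ) ≤ 1072 := by
  have : greenTailConst 7 ≤ 1072 := by
    simp only [greenTailConst, coeffAll, Finset.sum_Ico_eq_sum_range, Finset.sum_range_succ, Finset.sum_range_zero]
    norm_num [chernoffCoeff, chernoffCoeffHigh]
  exact_mod_cast this

/-- `T₈ ≤ 750`. [cite: HaraSladeSokal1993, Appendix A.1 pp. 27–30 (1/d expansion of C₀(0,x;1/2d)); lane plumbing] -/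
theorem greenTailConst_eight_le : (greenTailConst 8 : ℝ) ≤ 750 := by
  have : greenTailConst 8 ≤ 750 := by
    simp only [greenTailConst, coeffAll, Finset.sum_Ico_eq_sum_range, Finset.sum_range_succ, Finset.sum_range_zero]
    norm_num [chernoffCoeff, chernoffCoeffHigh]
  exact_mod_cast this

/-- `T₉ ≤ 633`. [cite: HaraSladeSokal1993, Appendix A.1 pp. 27–30 (1/d expansion of C₀(0,x;1/2d)); lane plumbing] -/
theorem greenTailConst_nine_le : (greenTailConst 9 : ℝ) ≤ 633 := by
  have : greenTailConst 9 ≤ 633 := by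
    simp only [greenTailConst, coeffAll, Finset.sum_Ico_eq_sum_range, Finset.sum_range_succ, Finset.sum_range_zero]
    norm_num [chernoffCoeff, chernoffCoeffHigh]
  exact_mod_cast this

/-- **`G(0) − Σ_{m<7} p_{2m}(0) ≤ 1072/d⁶`** (`d ≥ 22`). [cite: HaraSladeSokal1993, Appendix A.1 pp. 28–30 and Table 4 (C₀(0,0;1/2d) = G_d, via the
Bessel representation); lane certificate] -/
theorem srwI_one_zero_sub_sum_seven_le (hd : 22 ≤ d) :
    srwI d 1 0 0 - ∑ m ∈ range 7, srwLaw d (2 * m) 0 ≤ 1072 / (d : ℝ) ^ 6 := by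
  have hd0 : (0 : ℝ) < d := by exact_mod_cast (show 0 < d by omega)
  have hd6 : (0 : ℝ) < (d : ℝ) ^ 6 := by positivity
  exact (srwI_one_zero_sub_sum_le hd (by norm_num) (by norm_num)).trans
    (div_le_div_of_nonneg_right greenTailConst_seven_le hd6.le)

/-- **`G(0) − Σ_{m<8} p_{2m}(0) ≤ 750/d⁶`** (`d ≥ 22`). [cite: HaraSladeSokal1993, Appendix A.1 pp. 28–30 and Table 4 (C₀(0,0;1/2d) = G_d, via the
Bessel representation); lane certificate] -/
theorem srwI_one_zero_sub_sum_eight_le (hd : 22 ≤ d) :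
    srwI d 1 0 0 - ∑ m ∈ range 8, srwLaw d (2 * m) 0 ≤ 750 / (d : ℝ) ^ 6 := by
  have hd0 : (0 : ℝ) < d := by exact_mod_cast (show 0 < d by omega)
  have hd6 : (0 : ℝ) < (d : ℝ) ^ 6 := by positivity
  exact (srwI_one_zero_sub_sum_le hd (by norm_num) (by norm_num)).trans
    (div_le_div_of_nonneg_right greenTailConst_eight_le hd6.le)

/-- **`G(0) − Σ_{m<9} p_{2m}(0) ≤ 633/d⁶`** (`d ≥ 22`). [cite: HaraSladeSokal1993, Appendix A.1 pp. 28–30 and Table 4 (C₀(0,0;1/2d) = G_d, via the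
Bessel representation); lane certificate] -/
theorem srwI_one_zero_sub_sum_nine_le (hd : 22 ≤ d) :
    srwI d 1 0 0 - ∑ m ∈ range 9, srwLaw d (2 * m) 0 ≤ 633 / (d : ℝ) ^ 6 := by
  have hd0 : (0 : ℝ) < d := by exact_mod_cast (show 0 < d by omega)
  have hd6 : (0 : ℝ) < (d : ℝ) ^ 6 := by positivity
  exact (srwI_one_zero_sub_sum_le hd (by norm_num) (by norm_num)).trans
    (div_le_div_of_nonneg_right greenTailConst_nine_le hd6.le)

/-- **Lower origin head**: `Σ_{m<M} p_{2m}(0) ≤ G(0)` (`d ≥ 3`). [cite: HaraSladeSokal1993, Appendix A.1 pp. 27–30 (1/d expansion of C₀(0,x;1/2d));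
lane plumbing] -/
theorem sum_range_le_srwI_one_zero (hd : 3 ≤ d) (M : ℕ) :
    ∑ m ∈ range M, srwLaw d (2 * m) 0 ≤ srwI d 1 0 0 := by
  rw [GreenCert.srwI_one_eq_sum_add_tsum hd M]
  have : 0 ≤ ∑' j, srwLaw d (2 * (M + j)) 0 := tsum_nonneg fun j => srwLaw_nonneg _ _
  linarith

/-- **Even-indexing of the origin partial sums**: `Σ_{i<N} p_i(0) = Σ_{m<(N+1)/2} p_{2m}(0)`. [cite: HaraSladeSokal1993, Appendix A.1 pp. 27–30 (1/d
expansion of C₀(0,x;1/2d)); lane plumbing] -/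
theorem sum_range_srwLaw_zero_eq_even (d N : ℕ) :
    ∑ i ∈ range N, srwLaw d i (0 : Fin d → ℤ) = ∑ m ∈ range ((N + 1) / 2), srwLaw d (2 * m) 0 := by
  induction N with
  | zero => simp
  | succ N ih =>
      rw [sum_range_succ, ih]
      rcases Nat.even_or_odd N with ⟨k, hk⟩ | ⟨k, hk⟩
      · subst hk
        rw [show (k + k + 1 + 1) / 2 = k + 1 by omega, show (k + k + 1) / 2 = k by omega, sum_range_succ,
          show k + k = 2 * k by ring]
      · subst hk
        rw [show (2 * k + 1 + 1 + 1) / 2 = k + 1 by omega, show (2 * k + 1 + 1) / 2 = k + 1 by omega,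
          srwLaw_odd_origin, add_zero]

/-! ### §3 The origin: `H₀(d) ≤ G(0) ≤ H₀(d) + 633/d⁶` -/

/-- **The origin head `H₀(d) = Σ_{m ≤ 16} p_m(0)`** in closed form (`u_{2m}(d)/(2d)^{2m}`, `SAWLoopErasureSrwOriginCounts`):
`1 + s + 3s² + 12s³ + 60s⁴ + 355s⁵ + 2380s⁶ + 17430s⁷ + 134190s⁸ + …` in `s = 1/(2d)`. [cite: HaraSladeSokal1993, Appendix A.1 pp. 27–30 ((A.7): the
1/d expansion of C₀(0,x;1/2d)) and Table 4; lane certificate] -/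
noncomputable def originHead (d : ℕ) : ℝ :=
  1 + (2 * (d : ℝ)) / (2 * (d : ℝ)) ^ 2 + (12 * (d : ℝ) ^ 2 - 6 * (d : ℝ)) / (2 * (d : ℝ)) ^ 4 + (120 * (d : ℝ) ^ 3 - 180 * (d : ℝ) ^ 2 +
      80 * (d : ℝ)) / (2 * (d : ℝ)) ^ 6 + (1680 * (d : ℝ) ^ 4 - 5040 * (d : ℝ) ^ 3 + 5740 * (d : ℝ) ^ 2 - 2310 * (d : ℝ)) / (2 * (d : ℝ)) ^ 8 +
      (30240 * (d : ℝ) ^ 5 - 151200 * (d : ℝ) ^ 4 + 315000 * (d : ℝ) ^ 3 - 308700 * (d : ℝ) ^ 2 + 114912 * (d : ℝ)) / (2 * (d : ℝ)) ^ 10 +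
      (665280 * (d : ℝ) ^ 6 - 4989600 * (d : ℝ) ^ 5 + 16354800 * (d : ℝ) ^ 4 - 28274400 * (d : ℝ) ^ 3 + 24985884 * (d : ℝ) ^ 2 -
      8741040 * (d : ℝ)) / (2 * (d : ℝ)) ^ 12 + (17297280 * (d : ℝ) ^ 7 - 181621440 * (d : ℝ) ^ 6 + 857656800 * (d : ℝ) ^ 5 -
      2270268000 * (d : ℝ) ^ 4 + 3469810344 * (d : ℝ) ^ 3 - 2835985152 * (d : ℝ) ^ 2 + 943113600 * (d : ℝ)) / (2 * (d : ℝ)) ^ 14 +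
      (518918400 * (d : ℝ) ^ 8 - 7264857600 * (d : ℝ) ^ 7 + 46616169600 * (d : ℝ) ^ 6 - 174053880000 * (d : ℝ) ^ 5 + 400894013520 * (d : ℝ) ^ 4 -
      559479800880 * (d : ℝ) ^ 3 + 429754447980 * (d : ℝ) ^ 2 - 136984998150 * (d : ℝ)) / (2 * (d : ℝ)) ^ 16

/-- `Σ_{m<9} p_{2m}(0) = H₀(d)`. [cite: HaraSladeSokal1993, Appendix A.1 pp. 27–30 ((A.7): the 1/d expansion of C₀(0,x;1/2d)) and Table 4; lane
certificate] -/
theorem sum_range_nine_eq_originHead (d : ℕ) :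
    ∑ m ∈ range 9, srwLaw d (2 * m) (0 : Fin d → ℤ) = originHead d := by
  simp only [sum_range_succ, sum_range_zero, zero_add, Nat.mul_zero, Nat.reduceMul, srwLaw_eq_srwCount_div,
    SrwDimRec.srwCount_origin_zero (R := ℝ) d, SrwDimRec.srwCount_origin_two (R := ℝ) d, SrwDimRec.srwCount_origin_four (R := ℝ) d,
        SrwDimRec.srwCount_origin_six (R := ℝ) d, SrwDimRec.srwCount_origin_eight (R := ℝ) d, SrwDimRec.srwCount_origin_ten (R := ℝ) d,
        SrwDimRec.srwCount_origin_twelve (R := ℝ) d, SrwDimRec.srwCount_origin_fourteen (R := ℝ) d, SrwDimRec.srwCount_origin_sixteen (R := ℝ) d,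
        pow_zero, div_one, originHead]

/-- **`H₀(d) ≤ G(0)`** (`d ≥ 3`). [cite: HaraSladeSokal1993, Appendix A.1 pp. 27–30 ((A.7): the 1/d expansion of C₀(0,x;1/2d)) and Table 4; lane
certificate] -/
theorem originHead_le (hd : 3 ≤ d) : originHead d ≤ srwI d 1 0 0 := by
  rw [← sum_range_nine_eq_originHead]
  exact sum_range_le_srwI_one_zero hd 9

/-- **`G(0) ≤ H₀(d) + 633/d⁶`** (`d ≥ 22`). [cite: HaraSladeSokal1993, Appendix A.1 pp. 27–30 ((A.7): the 1/d expansion of C₀(0,x;1/2d)) and Table 4;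
lane certificate] -/
theorem le_originHead_add (hd : 22 ≤ d) : srwI d 1 0 0 ≤ originHead d + 633 / (d : ℝ) ^ 6 := by
  have h := srwI_one_zero_sub_sum_nine_le hd
  rw [sum_range_nine_eq_originHead] at h
  linarith

/-! ### §4 The class of `e₁` (the neighbour `x = e₀`): `H(d) ≤ G(x) ≤ H(d) + 750/d⁶` -/

/-- **The head `H_{e₁}(d) = Σ_{m ≤ 13} p_m(x)`** in closed form (`v_m(d)/(2d)^m`, `SAWLoopErasureSrwNeighbourCounts`):
`s + 3s² + 12s³ + 60s⁴ + 355s⁵ + 2380s⁶ + 17430s⁷ (= H₀ − 1 through s⁷)` in `s = 1/(2d)`. [cite: HaraSladeSokal1993, Appendix A.1 pp. 27–30 ((A.7):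
the 1/d expansion of C₀(0,x;1/2d)) and Table 4; lane certificate] -/
noncomputable def headAxisOne (d : ℕ) : ℝ :=
  (1) / (2 * (d : ℝ)) ^ 1 + (6 * (d : ℝ) - 3) / (2 * (d : ℝ)) ^ 3 + (60 * (d : ℝ) ^ 2 - 90 * (d : ℝ) + 40) / (2 * (d : ℝ)) ^ 5 + (840 * (d : ℝ) ^ 3 -
      2520 * (d : ℝ) ^ 2 + 2870 * (d : ℝ) - 1155) / (2 * (d : ℝ)) ^ 7 + (15120 * (d : ℝ) ^ 4 - 75600 * (d : ℝ) ^ 3 + 157500 * (d : ℝ) ^ 2 -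
      154350 * (d : ℝ) + 57456) / (2 * (d : ℝ)) ^ 9 + (332640 * (d : ℝ) ^ 5 - 2494800 * (d : ℝ) ^ 4 + 8177400 * (d : ℝ) ^ 3 -
      14137200 * (d : ℝ) ^ 2 + 12492942 * (d : ℝ) - 4370520) / (2 * (d : ℝ)) ^ 11 + (8648640 * (d : ℝ) ^ 6 - 90810720 * (d : ℝ) ^ 5 +
      428828400 * (d : ℝ) ^ 4 - 1135134000 * (d : ℝ) ^ 3 + 1734905172 * (d : ℝ) ^ 2 - 1417992576 * (d : ℝ) + 471556800) / (2 * (d : ℝ)) ^ 13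

/-- `Σ_{i<15} p_i(x) = H_{e₁}(d)` (`d ≥ 1`). [cite: HaraSladeSokal1993, Appendix A.1 pp. 27–30 ((A.7): the 1/d expansion of C₀(0,x;1/2d)) and Table
4; lane certificate] -/
theorem sum_range_eq_headAxisOne {x : Fin d → ℤ} (hk : 1 ≤ d) (h0 : coordD x 0 = 1) (hz : ∀ i, 1 ≤ i → coordD x i = 0) :
    ∑ i ∈ range 15, srwLaw d i x = headAxisOne d := by
  have hv : ∀ m : ℕ, srwLaw d (2 * m) x = 0 := srwLaw_axisOne_even hk h0 hz
  simp only [sum_range_succ, sum_range_zero, zero_add]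
  rw [show srwLaw d 0 x = 0 from hv 0, show srwLaw d 2 x = 0 from hv 1, show srwLaw d 4 x = 0 from hv 2, show srwLaw d 6 x = 0 from hv 3,
      show srwLaw d 8 x = 0 from hv 4, show srwLaw d 10 x = 0 from hv 5, show srwLaw d 12 x = 0 from hv 6, show srwLaw d 14 x = 0 from hv 7]
  simp only [srwLaw_eq_srwCount_div, show ∀ m, srwCount d m x = G x d m from fun m => rfl,
    SrwDimRec.G_axisOne_one (R := ℝ) h0 hz d hk, SrwDimRec.G_axisOne_three (R := ℝ) h0 hz d hk, SrwDimRec.G_axisOne_five (R := ℝ) h0 hz d hk,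
        SrwDimRec.G_axisOne_seven (R := ℝ) h0 hz d hk, SrwDimRec.G_axisOne_nine (R := ℝ) h0 hz d hk, SrwDimRec.G_axisOne_eleven (R := ℝ) h0 hz d hk,
        SrwDimRec.G_axisOne_thirteen (R := ℝ) h0 hz d hk, add_zero, zero_add, headAxisOne]

/-- **`H_{e₁}(d) ≤ G(x)`** (`d ≥ 22`). [cite: HaraSladeSokal1993, Appendix A.1 pp. 27–30 ((A.7): the 1/d expansion of C₀(0,x;1/2d)) and Table 4; lane
certificate] -/
theorem headAxisOne_le {x : Fin d → ℤ} (hd : 22 ≤ d) (h0 : coordD x 0 = 1) (hz : ∀ i, 1 ≤ i → coordD x i = 0) :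
    headAxisOne d ≤ srwI d 1 0 x := by
  have h := srwI_one_eq_sum_add (by omega) 0 15 x
  simp only [zero_add] at h
  rw [sum_range_eq_headAxisOne (by omega) h0 hz] at h
  have h0 : 0 ≤ srwI d 1 15 x := srwI_nonneg 1 (by omega) 15 x
  linarith

/-- **`G(x) ≤ H_{e₁}(d) + 750/d⁶`** (`d ≥ 22`; the remainder is `I_{1,15}(x) ≤ I_{1,15}(0) = G(0) − Σ_{m<8} p_{2m}(0)`). [cite: HaraSladeSokal1993,
Appendix A.1 pp. 27–30 ((A.7): the 1/d expansion of C₀(0,x;1/2d)) and Table 4; lane certificate] -/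
theorem le_headAxisOne_add {x : Fin d → ℤ} (hd : 22 ≤ d) (h0 : coordD x 0 = 1) (hz : ∀ i, 1 ≤ i → coordD x i = 0) :
    srwI d 1 0 x ≤ headAxisOne d + 750 / (d : ℝ) ^ 6 := by
  have h := srwI_one_le_sum_add_zero (by omega) 0 15 x
  have hs := srwI_one_shift_zero_eq (d := d) (by omega) 0 15
  simp only [zero_add] at h hs
  rw [sum_range_eq_headAxisOne (by omega) h0 hz] at h
  rw [sum_range_srwLaw_zero_eq_even, show (15 + 1) / 2 = 8 by norm_num] at hs
  have ht := srwI_one_zero_sub_sum_eight_le hd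
  linarith

/-! ### §5 The class of `2e₁` (the axis site `x = 2e₀`): `H(d) ≤ G(x) ≤ H(d) + 1072/d⁶` -/

/-- **The head `H_{2e₁}(d) = Σ_{m ≤ 12} p_m(x)`** in closed form (`v_m(d)/(2d)^m`, `SAWLoopErasureSrwNeighbourCounts`):
`s² + 6s³ + 37s⁴ + 255s⁵ + 1950s⁶ + 16240s⁷ + …` in `s = 1/(2d)`. [cite: HaraSladeSokal1993, Appendix A.1 pp. 27–30 ((A.7): the 1/d expansion of
C₀(0,x;1/2d)) and Table 4; lane certificate] -/
noncomputable def headAxisTwo (d : ℕ) : ℝ :=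
  (1) / (2 * (d : ℝ)) ^ 2 + (12 * (d : ℝ) - 8) / (2 * (d : ℝ)) ^ 4 + (180 * (d : ℝ) ^ 2 - 330 * (d : ℝ) + 165) / (2 * (d : ℝ)) ^ 6 +
      (3360 * (d : ℝ) ^ 3 - 11760 * (d : ℝ) ^ 2 + 14840 * (d : ℝ) - 6384) / (2 * (d : ℝ)) ^ 8 + (75600 * (d : ℝ) ^ 4 - 428400 * (d : ℝ) ^ 3 +
      976500 * (d : ℝ) ^ 2 - 1020810 * (d : ℝ) + 397320) / (2 * (d : ℝ)) ^ 10 + (1995840 * (d : ℝ) ^ 5 - 16632000 * (d : ℝ) ^ 4 +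
      59043600 * (d : ℝ) ^ 3 - 108468360 * (d : ℝ) ^ 2 + 100335312 * (d : ℝ) - 36273600) / (2 * (d : ℝ)) ^ 12

/-- `Σ_{i<14} p_i(x) = H_{2e₁}(d)` (`d ≥ 1`). [cite: HaraSladeSokal1993, Appendix A.1 pp. 27–30 ((A.7): the 1/d expansion of C₀(0,x;1/2d)) and Table
4; lane certificate] -/
theorem sum_range_eq_headAxisTwo {x : Fin d → ℤ} (hk : 1 ≤ d) (h0 : coordD x 0 = 2) (hz : ∀ i, 1 ≤ i → coordD x i = 0) :
    ∑ i ∈ range 14, srwLaw d i x = headAxisTwo d := by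
  have hv : ∀ m : ℕ, srwLaw d (2 * m + 1) x = 0 := srwLaw_axisTwo_odd hk h0 hz
  simp only [sum_range_succ, sum_range_zero, zero_add]
  rw [show srwLaw d 1 x = 0 from hv 0, show srwLaw d 3 x = 0 from hv 1, show srwLaw d 5 x = 0 from hv 2, show srwLaw d 7 x = 0 from hv 3,
      show srwLaw d 9 x = 0 from hv 4, show srwLaw d 11 x = 0 from hv 5, show srwLaw d 13 x = 0 from hv 6]
  simp only [srwLaw_eq_srwCount_div, show ∀ m, srwCount d m x = G x d m from fun m => rfl,
    SrwDimRec.G_axisTwo_zero (R := ℝ) h0 hz d hk, SrwDimRec.G_axisTwo_two (R := ℝ) h0 hz d hk, SrwDimRec.G_axisTwo_four (R := ℝ) h0 hz d hk,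
        SrwDimRec.G_axisTwo_six (R := ℝ) h0 hz d hk, SrwDimRec.G_axisTwo_eight (R := ℝ) h0 hz d hk, SrwDimRec.G_axisTwo_ten (R := ℝ) h0 hz d hk,
        SrwDimRec.G_axisTwo_twelve (R := ℝ) h0 hz d hk, add_zero, zero_add, zero_div, headAxisTwo]

/-- **`H_{2e₁}(d) ≤ G(x)`** (`d ≥ 22`). [cite: HaraSladeSokal1993, Appendix A.1 pp. 27–30 ((A.7): the 1/d expansion of C₀(0,x;1/2d)) and Table 4;
lane certificate] -/
theorem headAxisTwo_le {x : Fin d → ℤ} (hd : 22 ≤ d) (h0 : coordD x 0 = 2) (hz : ∀ i, 1 ≤ i → coordD x i = 0) :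
    headAxisTwo d ≤ srwI d 1 0 x := by
  have h := srwI_one_eq_sum_add (by omega) 0 14 x
  simp only [zero_add] at h
  rw [sum_range_eq_headAxisTwo (by omega) h0 hz] at h
  have h0 : 0 ≤ srwI d 1 14 x := srwI_nonneg 1 (by omega) 14 x
  linarith

/-- **`G(x) ≤ H_{2e₁}(d) + 1072/d⁶`** (`d ≥ 22`; the remainder is `I_{1,14}(x) ≤ I_{1,14}(0) = G(0) − Σ_{m<7} p_{2m}(0)`). [cite: HaraSladeSokal1993,
Appendix A.1 pp. 27–30 ((A.7): the 1/d expansion of C₀(0,x;1/2d)) and Table 4; lane certificate] -/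
theorem le_headAxisTwo_add {x : Fin d → ℤ} (hd : 22 ≤ d) (h0 : coordD x 0 = 2) (hz : ∀ i, 1 ≤ i → coordD x i = 0) :
    srwI d 1 0 x ≤ headAxisTwo d + 1072 / (d : ℝ) ^ 6 := by
  have h := srwI_one_le_sum_add_zero (by omega) 0 14 x
  have hs := srwI_one_shift_zero_eq (d := d) (by omega) 0 14
  simp only [zero_add] at h hs
  rw [sum_range_eq_headAxisTwo (by omega) h0 hz] at h
  rw [sum_range_srwLaw_zero_eq_even, show (14 + 1) / 2 = 7 by norm_num] at hs
  have ht := srwI_one_zero_sub_sum_seven_le hd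
  linarith

/-! ### §6 The class of `e₁+e₂` (the diagonal site `x = e₀ + e₁`): `H(d) ≤ G(x) ≤ H(d) + 1072/d⁶` -/

/-- **The head `H_{e₁+e₂}(d) = Σ_{m ≤ 12} p_m(x)`** in closed form (`v_m(d)/(2d)^m`, `SAWLoopErasureSrwNeighbourCounts`):
`2s² + 12s³ + 66s⁴ + 390s⁵ + 2550s⁶ + 18200s⁷ + …` in `s = 1/(2d)`. [cite: HaraSladeSokal1993, Appendix A.1 pp. 27–30 ((A.7): the 1/d expansion of
C₀(0,x;1/2d)) and Table 4; lane certificate] -/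
noncomputable def headPair (d : ℕ) : ℝ :=
  (2) / (2 * (d : ℝ)) ^ 2 + (24 * (d : ℝ) - 24) / (2 * (d : ℝ)) ^ 4 + (360 * (d : ℝ) ^ 2 - 900 * (d : ℝ) + 660) / (2 * (d : ℝ)) ^ 6 +
      (6720 * (d : ℝ) ^ 3 - 30240 * (d : ℝ) ^ 2 + 51520 * (d : ℝ) - 31920) / (2 * (d : ℝ)) ^ 8 + (151200 * (d : ℝ) ^ 4 - 1058400 * (d : ℝ) ^ 3 +
      3087000 * (d : ℝ) ^ 2 - 4315500 * (d : ℝ) + 2383920) / (2 * (d : ℝ)) ^ 10 + (3991680 * (d : ℝ) ^ 5 - 39916800 * (d : ℝ) ^ 4 +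
      174636000 * (d : ℝ) ^ 3 - 408315600 * (d : ℝ) ^ 2 + 500878224 * (d : ℝ) - 253915200) / (2 * (d : ℝ)) ^ 12

/-- `Σ_{i<14} p_i(x) = H_{e₁+e₂}(d)` (`d ≥ 2`). [cite: HaraSladeSokal1993, Appendix A.1 pp. 27–30 ((A.7): the 1/d expansion of C₀(0,x;1/2d)) and
Table 4; lane certificate] -/
theorem sum_range_eq_headPair {x : Fin d → ℤ} (hk : 2 ≤ d) (h0 : coordD x 0 = 1) (h1 : coordD x 1 = 1) (hz : ∀ i, 2 ≤ i → coordD x i = 0) :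
    ∑ i ∈ range 14, srwLaw d i x = headPair d := by
  have hv : ∀ m : ℕ, srwLaw d (2 * m + 1) x = 0 := srwLaw_pair_odd hk h0 h1 hz
  simp only [sum_range_succ, sum_range_zero, zero_add]
  rw [show srwLaw d 1 x = 0 from hv 0, show srwLaw d 3 x = 0 from hv 1, show srwLaw d 5 x = 0 from hv 2, show srwLaw d 7 x = 0 from hv 3,
      show srwLaw d 9 x = 0 from hv 4, show srwLaw d 11 x = 0 from hv 5, show srwLaw d 13 x = 0 from hv 6]
  simp only [srwLaw_eq_srwCount_div, show ∀ m, srwCount d m x = G x d m from fun m => rfl,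
    SrwDimRec.G_pair_zero (R := ℝ) h0 h1 hz d hk, SrwDimRec.G_pair_two (R := ℝ) h0 h1 hz d hk, SrwDimRec.G_pair_four (R := ℝ) h0 h1 hz d hk,
        SrwDimRec.G_pair_six (R := ℝ) h0 h1 hz d hk, SrwDimRec.G_pair_eight (R := ℝ) h0 h1 hz d hk, SrwDimRec.G_pair_ten (R := ℝ) h0 h1 hz d hk,
        SrwDimRec.G_pair_twelve (R := ℝ) h0 h1 hz d hk, add_zero, zero_add, zero_div, headPair]

/-- **`H_{e₁+e₂}(d) ≤ G(x)`** (`d ≥ 22`). [cite: HaraSladeSokal1993, Appendix A.1 pp. 27–30 ((A.7): the 1/d expansion of C₀(0,x;1/2d)) and Table 4;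
lane certificate] -/
theorem headPair_le {x : Fin d → ℤ} (hd : 22 ≤ d) (h0 : coordD x 0 = 1) (h1 : coordD x 1 = 1) (hz : ∀ i, 2 ≤ i → coordD x i = 0) :
    headPair d ≤ srwI d 1 0 x := by
  have h := srwI_one_eq_sum_add (by omega) 0 14 x
  simp only [zero_add] at h
  rw [sum_range_eq_headPair (by omega) h0 h1 hz] at h
  have h0 : 0 ≤ srwI d 1 14 x := srwI_nonneg 1 (by omega) 14 x
  linarith

/-- **`G(x) ≤ H_{e₁+e₂}(d) + 1072/d⁶`** (`d ≥ 22`; the remainder is `I_{1,14}(x) ≤ I_{1,14}(0) = G(0) − Σ_{m<7} p_{2m}(0)`). [cite: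
HaraSladeSokal1993, Appendix A.1 pp. 27–30 ((A.7): the 1/d expansion of C₀(0,x;1/2d)) and Table 4; lane certificate] -/
theorem le_headPair_add {x : Fin d → ℤ} (hd : 22 ≤ d) (h0 : coordD x 0 = 1) (h1 : coordD x 1 = 1) (hz : ∀ i, 2 ≤ i → coordD x i = 0) :
    srwI d 1 0 x ≤ headPair d + 1072 / (d : ℝ) ^ 6 := by
  have h := srwI_one_le_sum_add_zero (by omega) 0 14 x
  have hs := srwI_one_shift_zero_eq (d := d) (by omega) 0 14
  simp only [zero_add] at h hs
  rw [sum_range_eq_headPair (by omega) h0 h1 hz] at h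
  rw [sum_range_srwLaw_zero_eq_even, show (14 + 1) / 2 = 7 by norm_num] at hs
  have ht := srwI_one_zero_sub_sum_seven_le hd
  linarith

/-! ### §7 The class of `3e₁` (the axis site `x = 3e₀`): `H(d) ≤ G(x) ≤ H(d) + 750/d⁶` -/

/-- **The head `H_{3e₁}(d) = Σ_{m ≤ 13} p_m(x)`** in closed form (`v_m(d)/(2d)^m`, `SAWLoopErasureSrwNeighbourCounts`):
`s³ + 10s⁴ + 90s⁵ + 840s⁶ + …` in `s = 1/(2d)`. [cite: HaraSladeSokal1993, Appendix A.1 pp. 27–30 ((A.7): the 1/d expansion of C₀(0,x;1/2d)) and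
Table 4; lane certificate] -/
noncomputable def headAxisThree (d : ℕ) : ℝ :=
  (1) / (2 * (d : ℝ)) ^ 3 + (20 * (d : ℝ) - 15) / (2 * (d : ℝ)) ^ 5 + (420 * (d : ℝ) ^ 2 - 840 * (d : ℝ) + 441) / (2 * (d : ℝ)) ^ 7 +
      (10080 * (d : ℝ) ^ 3 - 37800 * (d : ℝ) ^ 2 + 49812 * (d : ℝ) - 22008) / (2 * (d : ℝ)) ^ 9 + (277200 * (d : ℝ) ^ 4 - 1663200 * (d : ℝ) ^ 3 +
      3940860 * (d : ℝ) ^ 2 - 4229610 * (d : ℝ) + 1675080) / (2 * (d : ℝ)) ^ 11 + (8648640 * (d : ℝ) ^ 5 - 75675600 * (d : ℝ) ^ 4 +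
      278197920 * (d : ℝ) ^ 3 - 524143620 * (d : ℝ) ^ 2 + 493726662 * (d : ℝ) - 180752715) / (2 * (d : ℝ)) ^ 13

/-- `Σ_{i<15} p_i(x) = H_{3e₁}(d)` (`d ≥ 1`). [cite: HaraSladeSokal1993, Appendix A.1 pp. 27–30 ((A.7): the 1/d expansion of C₀(0,x;1/2d)) and Table
4; lane certificate] -/
theorem sum_range_eq_headAxisThree {x : Fin d → ℤ} (hk : 1 ≤ d) (h0 : coordD x 0 = 3) (hz : ∀ i, 1 ≤ i → coordD x i = 0) :
    ∑ i ∈ range 15, srwLaw d i x = headAxisThree d := by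
  have hv : ∀ m : ℕ, srwLaw d (2 * m) x = 0 := srwLaw_axisThree_even hk h0 hz
  simp only [sum_range_succ, sum_range_zero, zero_add]
  rw [show srwLaw d 0 x = 0 from hv 0, show srwLaw d 2 x = 0 from hv 1, show srwLaw d 4 x = 0 from hv 2, show srwLaw d 6 x = 0 from hv 3,
      show srwLaw d 8 x = 0 from hv 4, show srwLaw d 10 x = 0 from hv 5, show srwLaw d 12 x = 0 from hv 6, show srwLaw d 14 x = 0 from hv 7]
  simp only [srwLaw_eq_srwCount_div, show ∀ m, srwCount d m x = G x d m from fun m => rfl,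
    SrwDimRec.G_axisThree_one (R := ℝ) h0 hz d hk, SrwDimRec.G_axisThree_three (R := ℝ) h0 hz d hk, SrwDimRec.G_axisThree_five (R := ℝ) h0 hz d hk,
        SrwDimRec.G_axisThree_seven (R := ℝ) h0 hz d hk, SrwDimRec.G_axisThree_nine (R := ℝ) h0 hz d hk, SrwDimRec.G_axisThree_eleven (R :=
        ℝ) h0 hz d hk, SrwDimRec.G_axisThree_thirteen (R := ℝ) h0 hz d hk, add_zero, zero_add, zero_div, headAxisThree]

/-- **`H_{3e₁}(d) ≤ G(x)`** (`d ≥ 22`). [cite: HaraSladeSokal1993, Appendix A.1 pp. 27–30 ((A.7): the 1/d expansion of C₀(0,x;1/2d)) and Table 4;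
lane certificate] -/
theorem headAxisThree_le {x : Fin d → ℤ} (hd : 22 ≤ d) (h0 : coordD x 0 = 3) (hz : ∀ i, 1 ≤ i → coordD x i = 0) :
    headAxisThree d ≤ srwI d 1 0 x := by
  have h := srwI_one_eq_sum_add (by omega) 0 15 x
  simp only [zero_add] at h
  rw [sum_range_eq_headAxisThree (by omega) h0 hz] at h
  have h0 : 0 ≤ srwI d 1 15 x := srwI_nonneg 1 (by omega) 15 x
  linarith

/-- **`G(x) ≤ H_{3e₁}(d) + 750/d⁶`** (`d ≥ 22`; the remainder is `I_{1,15}(x) ≤ I_{1,15}(0) = G(0) − Σ_{m<8} p_{2m}(0)`). [cite: HaraSladeSokal1993,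
Appendix A.1 pp. 27–30 ((A.7): the 1/d expansion of C₀(0,x;1/2d)) and Table 4; lane certificate] -/
theorem le_headAxisThree_add {x : Fin d → ℤ} (hd : 22 ≤ d) (h0 : coordD x 0 = 3) (hz : ∀ i, 1 ≤ i → coordD x i = 0) :
    srwI d 1 0 x ≤ headAxisThree d + 750 / (d : ℝ) ^ 6 := by
  have h := srwI_one_le_sum_add_zero (by omega) 0 15 x
  have hs := srwI_one_shift_zero_eq (d := d) (by omega) 0 15
  simp only [zero_add] at h hs
  rw [sum_range_eq_headAxisThree (by omega) h0 hz] at h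
  rw [sum_range_srwLaw_zero_eq_even, show (15 + 1) / 2 = 8 by norm_num] at hs
  have ht := srwI_one_zero_sub_sum_eight_le hd
  linarith

/-! ### §8 The class of `2e₁+e₂` (the site `x = 2e₀ + e₁`): `H(d) ≤ G(x) ≤ H(d) + 750/d⁶` -/

/-- **The head `H_{2e₁+e₂}(d) = Σ_{m ≤ 13} p_m(x)`** in closed form (`v_m(d)/(2d)^m`, `SAWLoopErasureSrwNeighbourCounts`):
`3s³ + 30s⁴ + 245s⁵ + 1995s⁶ + …` in `s = 1/(2d)`. [cite: HaraSladeSokal1993, Appendix A.1 pp. 27–30 ((A.7): the 1/d expansion of C₀(0,x;1/2d)) and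
Table 4; lane certificate] -/
noncomputable def headAxisTwoOne (d : ℕ) : ℝ :=
  (3) / (2 * (d : ℝ)) ^ 3 + (60 * (d : ℝ) - 70) / (2 * (d : ℝ)) ^ 5 + (1260 * (d : ℝ) ^ 2 - 3570 * (d : ℝ) + 2835) / (2 * (d : ℝ)) ^ 7 +
      (30240 * (d : ℝ) ^ 3 - 151200 * (d : ℝ) ^ 2 + 277200 * (d : ℝ) - 180936) / (2 * (d : ℝ)) ^ 9 + (831600 * (d : ℝ) ^ 4 - 6375600 * (d : ℝ) ^ 3 +
      19889100 * (d : ℝ) ^ 2 - 29246910 * (d : ℝ) + 16789080) / (2 * (d : ℝ)) ^ 11 + (25945920 * (d : ℝ) ^ 5 - 281080800 * (d : ℝ) ^ 4 +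
      1308106800 * (d : ℝ) ^ 3 - 3210086880 * (d : ℝ) ^ 2 + 4091203116 * (d : ℝ) - 2137681260) / (2 * (d : ℝ)) ^ 13

/-- `Σ_{i<15} p_i(x) = H_{2e₁+e₂}(d)` (`d ≥ 2`). [cite: HaraSladeSokal1993, Appendix A.1 pp. 27–30 ((A.7): the 1/d expansion of C₀(0,x;1/2d)) and
Table 4; lane certificate] -/
theorem sum_range_eq_headAxisTwoOne {x : Fin d → ℤ} (hk : 2 ≤ d) (h0 : coordD x 0 = 2) (h1 : coordD x 1 = 1) (hz : ∀ i, 2 ≤ i → coordD x i = 0) :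
    ∑ i ∈ range 15, srwLaw d i x = headAxisTwoOne d := by
  have hv : ∀ m : ℕ, srwLaw d (2 * m) x = 0 := srwLaw_axisTwoOne_even hk h0 h1 hz
  simp only [sum_range_succ, sum_range_zero, zero_add]
  rw [show srwLaw d 0 x = 0 from hv 0, show srwLaw d 2 x = 0 from hv 1, show srwLaw d 4 x = 0 from hv 2, show srwLaw d 6 x = 0 from hv 3,
      show srwLaw d 8 x = 0 from hv 4, show srwLaw d 10 x = 0 from hv 5, show srwLaw d 12 x = 0 from hv 6, show srwLaw d 14 x = 0 from hv 7]
  simp only [srwLaw_eq_srwCount_div, show ∀ m, srwCount d m x = G x d m from fun m => rfl,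
    SrwDimRec.G_axisTwoOne_one (R := ℝ) h0 h1 hz d hk, SrwDimRec.G_axisTwoOne_three (R := ℝ) h0 h1 hz d hk, SrwDimRec.G_axisTwoOne_five (R :=
        ℝ) h0 h1 hz d hk, SrwDimRec.G_axisTwoOne_seven (R := ℝ) h0 h1 hz d hk, SrwDimRec.G_axisTwoOne_nine (R := ℝ) h0 h1 hz d hk,
        SrwDimRec.G_axisTwoOne_eleven (R := ℝ) h0 h1 hz d hk, SrwDimRec.G_axisTwoOne_thirteen (R := ℝ) h0 h1 hz d hk, add_zero, zero_add, zero_div,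
        headAxisTwoOne]

/-- **`H_{2e₁+e₂}(d) ≤ G(x)`** (`d ≥ 22`). [cite: HaraSladeSokal1993, Appendix A.1 pp. 27–30 ((A.7): the 1/d expansion of C₀(0,x;1/2d)) and Table 4;
lane certificate] -/
theorem headAxisTwoOne_le {x : Fin d → ℤ} (hd : 22 ≤ d) (h0 : coordD x 0 = 2) (h1 : coordD x 1 = 1) (hz : ∀ i, 2 ≤ i → coordD x i = 0) :
    headAxisTwoOne d ≤ srwI d 1 0 x := by
  have h := srwI_one_eq_sum_add (by omega) 0 15 x
  simp only [zero_add] at h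
  rw [sum_range_eq_headAxisTwoOne (by omega) h0 h1 hz] at h
  have h0 : 0 ≤ srwI d 1 15 x := srwI_nonneg 1 (by omega) 15 x
  linarith

/-- **`G(x) ≤ H_{2e₁+e₂}(d) + 750/d⁶`** (`d ≥ 22`; the remainder is `I_{1,15}(x) ≤ I_{1,15}(0) = G(0) − Σ_{m<8} p_{2m}(0)`). [cite:
HaraSladeSokal1993, Appendix A.1 pp. 27–30 ((A.7): the 1/d expansion of C₀(0,x;1/2d)) and Table 4; lane certificate] -/
theorem le_headAxisTwoOne_add {x : Fin d → ℤ} (hd : 22 ≤ d) (h0 : coordD x 0 = 2) (h1 : coordD x 1 = 1) (hz : ∀ i, 2 ≤ i → coordD x i = 0) :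
    srwI d 1 0 x ≤ headAxisTwoOne d + 750 / (d : ℝ) ^ 6 := by
  have h := srwI_one_le_sum_add_zero (by omega) 0 15 x
  have hs := srwI_one_shift_zero_eq (d := d) (by omega) 0 15
  simp only [zero_add] at h hs
  rw [sum_range_eq_headAxisTwoOne (by omega) h0 h1 hz] at h
  rw [sum_range_srwLaw_zero_eq_even, show (15 + 1) / 2 = 8 by norm_num] at hs
  have ht := srwI_one_zero_sub_sum_eight_le hd
  linarith

/-! ### §9 The class of `e₁+e₂+e₃` (the site `x = e₀ + e₁ + e₂`): `H(d) ≤ G(x) ≤ H(d) + 750/d⁶` -/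

/-- **The head `H_{e₁+e₂+e₃}(d) = Σ_{m ≤ 13} p_m(x)`** in closed form (`v_m(d)/(2d)^m`, `SAWLoopErasureSrwNeighbourCounts`):
`6s³ + 60s⁴ + 450s⁵ + 3150s⁶ + …` in `s = 1/(2d)`. [cite: HaraSladeSokal1993, Appendix A.1 pp. 27–30 ((A.7): the 1/d expansion of C₀(0,x;1/2d)) and
Table 4; lane certificate] -/
noncomputable def headTriple (d : ℕ) : ℝ :=
  (6) / (2 * (d : ℝ)) ^ 3 + (120 * (d : ℝ) - 180) / (2 * (d : ℝ)) ^ 5 + (2520 * (d : ℝ) ^ 2 - 8820 * (d : ℝ) + 8820) / (2 * (d : ℝ)) ^ 7 +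
      (60480 * (d : ℝ) ^ 3 - 362880 * (d : ℝ) ^ 2 + 811440 * (d : ℝ) - 657720) / (2 * (d : ℝ)) ^ 9 + (1663200 * (d : ℝ) ^ 4 -
      14968800 * (d : ℝ) ^ 3 + 55578600 * (d : ℝ) ^ 2 - 98752500 * (d : ℝ) + 69688080) / (2 * (d : ℝ)) ^ 11 + (51891840 * (d : ℝ) ^ 5 -
      648648000 * (d : ℝ) ^ 4 + 3524320800 * (d : ℝ) ^ 3 - 10227016800 * (d : ℝ) ^ 2 + 15636092472 * (d : ℝ) - 9965395440) / (2 * (d : ℝ)) ^ 13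

/-- `Σ_{i<15} p_i(x) = H_{e₁+e₂+e₃}(d)` (`d ≥ 3`). [cite: HaraSladeSokal1993, Appendix A.1 pp. 27–30 ((A.7): the 1/d expansion of C₀(0,x;1/2d)) and
Table 4; lane certificate] -/
theorem sum_range_eq_headTriple {x : Fin d → ℤ} (hk : 3 ≤ d) (h0 : coordD x 0 = 1) (h1 : coordD x 1 = 1) (h2 : coordD x 2 = 1) (hz : ∀ i, 3 ≤ i →
    coordD x i = 0) :
    ∑ i ∈ range 15, srwLaw d i x = headTriple d := by
  have hv : ∀ m : ℕ, srwLaw d (2 * m) x = 0 := srwLaw_triple_even hk h0 h1 h2 hz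
  simp only [sum_range_succ, sum_range_zero, zero_add]
  rw [show srwLaw d 0 x = 0 from hv 0, show srwLaw d 2 x = 0 from hv 1, show srwLaw d 4 x = 0 from hv 2, show srwLaw d 6 x = 0 from hv 3,
      show srwLaw d 8 x = 0 from hv 4, show srwLaw d 10 x = 0 from hv 5, show srwLaw d 12 x = 0 from hv 6, show srwLaw d 14 x = 0 from hv 7]
  simp only [srwLaw_eq_srwCount_div, show ∀ m, srwCount d m x = G x d m from fun m => rfl,
    SrwDimRec.G_triple_one (R := ℝ) h0 h1 h2 hz d hk, SrwDimRec.G_triple_three (R := ℝ) h0 h1 h2 hz d hk, SrwDimRec.G_triple_five (R :=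
        ℝ) h0 h1 h2 hz d hk, SrwDimRec.G_triple_seven (R := ℝ) h0 h1 h2 hz d hk, SrwDimRec.G_triple_nine (R := ℝ) h0 h1 h2 hz d hk,
        SrwDimRec.G_triple_eleven (R := ℝ) h0 h1 h2 hz d hk, SrwDimRec.G_triple_thirteen (R := ℝ) h0 h1 h2 hz d hk, add_zero, zero_add, zero_div,
        headTriple]

/-- **`H_{e₁+e₂+e₃}(d) ≤ G(x)`** (`d ≥ 22`). [cite: HaraSladeSokal1993, Appendix A.1 pp. 27–30 ((A.7): the 1/d expansion of C₀(0,x;1/2d)) and Table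
4; lane certificate] -/
theorem headTriple_le {x : Fin d → ℤ} (hd : 22 ≤ d) (h0 : coordD x 0 = 1) (h1 : coordD x 1 = 1) (h2 : coordD x 2 = 1) (hz : ∀ i, 3 ≤ i → coordD x i =
    0) :
    headTriple d ≤ srwI d 1 0 x := by
  have h := srwI_one_eq_sum_add (by omega) 0 15 x
  simp only [zero_add] at h
  rw [sum_range_eq_headTriple (by omega) h0 h1 h2 hz] at h
  have h0 : 0 ≤ srwI d 1 15 x := srwI_nonneg 1 (by omega) 15 x
  linarith

/-- **`G(x) ≤ H_{e₁+e₂+e₃}(d) + 750/d⁶`** (`d ≥ 22`; the remainder is `I_{1,15}(x) ≤ I_{1,15}(0) = G(0) − Σ_{m<8} p_{2m}(0)`). [cite: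
HaraSladeSokal1993, Appendix A.1 pp. 27–30 ((A.7): the 1/d expansion of C₀(0,x;1/2d)) and Table 4; lane certificate] -/
theorem le_headTriple_add {x : Fin d → ℤ} (hd : 22 ≤ d) (h0 : coordD x 0 = 1) (h1 : coordD x 1 = 1) (h2 : coordD x 2 = 1) (hz : ∀ i, 3 ≤ i →
    coordD x i = 0) :
    srwI d 1 0 x ≤ headTriple d + 750 / (d : ℝ) ^ 6 := by
  have h := srwI_one_le_sum_add_zero (by omega) 0 15 x
  have hs := srwI_one_shift_zero_eq (d := d) (by omega) 0 15
  simp only [zero_add] at h hs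
  rw [sum_range_eq_headTriple (by omega) h0 h1 h2 hz] at h
  rw [sum_range_srwLaw_zero_eq_even, show (15 + 1) / 2 = 8 by norm_num] at hs
  have ht := srwI_one_zero_sub_sum_eight_le hd
  linarith

/-! ### §10 The seven enclosures at the canonical representatives `a • e₀ + b • e₁ + c • e₂` (`d ≥ 22`)

The `(2̃,1)` system of HSS93 (3.13)–(3.14) (`SAWLoopErasureMemoryTwoTildeOneSystem`) is stated at the sites `0`, `stepVec t`,
`2 • stepVec t`, `stepVec t + stepVec u`, `3 • stepVec t`, `2 • stepVec t + stepVec u`, `stepVec t + stepVec u + stepVec r`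
for pairwise perpendicular directions; here they are served for `t₀ = (0,+)`, `u₀ = (1,+)`, `r₀ = (2,+)`. -/

/-- `(a • e_k)_i = a·[i = k]`. [cite: HaraSladeSokal1993, Appendix A.1 pp. 27–30 (1/d expansion of C₀(0,x;1/2d)); lane plumbing] -/
theorem coordD_zsmul_stepVec (a : ℤ) (k : Fin d) (i : ℕ) :
    coordD (a • stepVec (k, true)) i = if i = k.val then a else 0 := by
  unfold coordD
  by_cases hi : i < d
  · rw [dif_pos hi, Pi.smul_apply, stepVec_apply]
    by_cases h : i = k.val
    · rw [if_pos (Fin.ext h), if_pos h]; simp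
    · rw [if_neg (fun e => h (congrArg Fin.val e)), if_neg h, smul_zero]
  · rw [dif_neg hi, if_neg (fun e : i = k.val => hi (e ▸ k.isLt))]

/-- `(e_k)_i = [i = k]`. [cite: HaraSladeSokal1993, Appendix A.1 pp. 27–30 (1/d expansion of C₀(0,x;1/2d)); lane plumbing] -/
theorem coordD_stepVec (k : Fin d) (i : ℕ) : coordD (stepVec (k, true)) i = if i = k.val then 1 else 0 := by
  rw [← coordD_zsmul_stepVec 1 k i, one_zsmul]

/-- `(x + y)_i = x_i + y_i`. [cite: HaraSladeSokal1993, Appendix A.1 pp. 27–30 (1/d expansion of C₀(0,x;1/2d)); lane plumbing] -/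
theorem coordD_add (x y : Fin d → ℤ) (i : ℕ) : coordD (x + y) i = coordD x i + coordD y i := by
  unfold coordD; split_ifs <;> simp

/-- **`G(0)` two-sided** (`d ≥ 22`): `H₀(d) ≤ G(0) ≤ H₀(d) + 633/d⁶`. [cite: HaraSladeSokal1993, Appendix A.1 pp. 27–30 ((A.7): the 1/d expansion of
C₀(0,x;1/2d)) and Table 4; lane certificate] -/
theorem green_origin_bounds (hd : 22 ≤ d) :
    originHead d ≤ srwI d 1 0 0 ∧ srwI d 1 0 0 ≤ originHead d + 633 / (d : ℝ) ^ 6 :=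
  ⟨originHead_le (by omega), le_originHead_add hd⟩

/-- **`G(e₀)` two-sided** (`d ≥ 22`). [cite: HaraSladeSokal1993, Appendix A.1 pp. 27–30 ((A.7): the 1/d expansion of C₀(0,x;1/2d)) and Table 4; lane
certificate] -/
theorem green_one_bounds (hd : 22 ≤ d) :
    headAxisOne d ≤ srwI d 1 0 (stepVec ((⟨0, by omega⟩ : Fin d), true)) ∧
      srwI d 1 0 (stepVec ((⟨0, by omega⟩ : Fin d), true)) ≤ headAxisOne d + 750 / (d : ℝ) ^ 6 := by
  have h0 : coordD (stepVec ((⟨0, by omega⟩ : Fin d), true)) 0 = 1 := by simp only [coordD_stepVec]; simp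
  have hz : ∀ i, 1 ≤ i → coordD (stepVec ((⟨0, by omega⟩ : Fin d), true)) i = 0 := fun i hi => by
    have : i ≠ 0 := by omega
    simp only [coordD_stepVec]; simp [this]
  exact ⟨headAxisOne_le hd h0 hz, le_headAxisOne_add hd h0 hz⟩

/-- **`G(2e₀)` two-sided** (`d ≥ 22`). [cite: HaraSladeSokal1993, Appendix A.1 pp. 27–30 ((A.7): the 1/d expansion of C₀(0,x;1/2d)) and Table 4; lane
certificate] -/
theorem green_two_bounds (hd : 22 ≤ d) :
    headAxisTwo d ≤ srwI d 1 0 ((2 : ℤ) • stepVec ((⟨0, by omega⟩ : Fin d), true)) ∧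
      srwI d 1 0 ((2 : ℤ) • stepVec ((⟨0, by omega⟩ : Fin d), true)) ≤ headAxisTwo d + 1072 / (d : ℝ) ^ 6 := by
  have h0 : coordD ((2 : ℤ) • stepVec ((⟨0, by omega⟩ : Fin d), true)) 0 = 2 := by simp only [coordD_zsmul_stepVec]; simp
  have hz : ∀ i, 1 ≤ i → coordD ((2 : ℤ) • stepVec ((⟨0, by omega⟩ : Fin d), true)) i = 0 := fun i hi => by
    have : i ≠ 0 := by omega
    simp only [coordD_zsmul_stepVec]; simp [this]
  exact ⟨headAxisTwo_le hd h0 hz, le_headAxisTwo_add hd h0 hz⟩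

/-- **`G(e₀+e₁)` two-sided** (`d ≥ 22`). [cite: HaraSladeSokal1993, Appendix A.1 pp. 27–30 ((A.7): the 1/d expansion of C₀(0,x;1/2d)) and Table 4;
lane certificate] -/
theorem green_pair_bounds (hd : 22 ≤ d) :
    headPair d ≤ srwI d 1 0 (stepVec ((⟨0, by omega⟩ : Fin d), true) + stepVec ((⟨1, by omega⟩ : Fin d), true)) ∧
      srwI d 1 0 (stepVec ((⟨0, by omega⟩ : Fin d), true) + stepVec ((⟨1, by omega⟩ : Fin d), true)) ≤
        headPair d + 1072 / (d : ℝ) ^ 6 := by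
  have h0 : coordD (stepVec ((⟨0, by omega⟩ : Fin d), true) + stepVec ((⟨1, by omega⟩ : Fin d), true)) 0 = 1 := by
    simp only [coordD_add, coordD_stepVec]; simp
  have h1 : coordD (stepVec ((⟨0, by omega⟩ : Fin d), true) + stepVec ((⟨1, by omega⟩ : Fin d), true)) 1 = 1 := by
    simp only [coordD_add, coordD_stepVec]; simp
  have hz : ∀ i, 2 ≤ i →
      coordD (stepVec ((⟨0, by omega⟩ : Fin d), true) + stepVec ((⟨1, by omega⟩ : Fin d), true)) i = 0 := fun i hi => by
    have h0' : i ≠ 0 := by omega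
    have h1' : i ≠ 1 := by omega
    simp only [coordD_add, coordD_stepVec]; simp [h0', h1']
  exact ⟨headPair_le hd h0 h1 hz, le_headPair_add hd h0 h1 hz⟩

/-- **`G(3e₀)` two-sided** (`d ≥ 22`). [cite: HaraSladeSokal1993, Appendix A.1 pp. 27–30 ((A.7): the 1/d expansion of C₀(0,x;1/2d)) and Table 4; lane
certificate] -/
theorem green_three_bounds (hd : 22 ≤ d) :
    headAxisThree d ≤ srwI d 1 0 ((3 : ℤ) • stepVec ((⟨0, by omega⟩ : Fin d), true)) ∧
      srwI d 1 0 ((3 : ℤ) • stepVec ((⟨0, by omega⟩ : Fin d), true)) ≤ headAxisThree d + 750 / (d : ℝ) ^ 6 := by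
  have h0 : coordD ((3 : ℤ) • stepVec ((⟨0, by omega⟩ : Fin d), true)) 0 = 3 := by simp only [coordD_zsmul_stepVec]; simp
  have hz : ∀ i, 1 ≤ i → coordD ((3 : ℤ) • stepVec ((⟨0, by omega⟩ : Fin d), true)) i = 0 := fun i hi => by
    have : i ≠ 0 := by omega
    simp only [coordD_zsmul_stepVec]; simp [this]
  exact ⟨headAxisThree_le hd h0 hz, le_headAxisThree_add hd h0 hz⟩

/-- **`G(2e₀+e₁)` two-sided** (`d ≥ 22`). [cite: HaraSladeSokal1993, Appendix A.1 pp. 27–30 ((A.7): the 1/d expansion of C₀(0,x;1/2d)) and Table 4;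
lane certificate] -/
theorem green_twoOne_bounds (hd : 22 ≤ d) :
    headAxisTwoOne d ≤
        srwI d 1 0 ((2 : ℤ) • stepVec ((⟨0, by omega⟩ : Fin d), true) + stepVec ((⟨1, by omega⟩ : Fin d), true)) ∧
      srwI d 1 0 ((2 : ℤ) • stepVec ((⟨0, by omega⟩ : Fin d), true) + stepVec ((⟨1, by omega⟩ : Fin d), true)) ≤
        headAxisTwoOne d + 750 / (d : ℝ) ^ 6 := by
  have h0 : coordD ((2 : ℤ) • stepVec ((⟨0, by omega⟩ : Fin d), true) + stepVec ((⟨1, by omega⟩ : Fin d), true)) 0 = 2 := by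
    simp only [coordD_add, coordD_zsmul_stepVec, coordD_stepVec]; simp
  have h1 : coordD ((2 : ℤ) • stepVec ((⟨0, by omega⟩ : Fin d), true) + stepVec ((⟨1, by omega⟩ : Fin d), true)) 1 = 1 := by
    simp only [coordD_add, coordD_zsmul_stepVec, coordD_stepVec]; simp
  have hz : ∀ i, 2 ≤ i →
      coordD ((2 : ℤ) • stepVec ((⟨0, by omega⟩ : Fin d), true) + stepVec ((⟨1, by omega⟩ : Fin d), true)) i = 0 :=
    fun i hi => by
      have h0' : i ≠ 0 := by omega
      have h1' : i ≠ 1 := by omega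
      simp only [coordD_add, coordD_zsmul_stepVec, coordD_stepVec]; simp [h0', h1']
  exact ⟨headAxisTwoOne_le hd h0 h1 hz, le_headAxisTwoOne_add hd h0 h1 hz⟩

/-- **`G(e₀+e₁+e₂)` two-sided** (`d ≥ 22`). [cite: HaraSladeSokal1993, Appendix A.1 pp. 27–30 ((A.7): the 1/d expansion of C₀(0,x;1/2d)) and Table 4;
lane certificate] -/
theorem green_triple_bounds (hd : 22 ≤ d) :
    headTriple d ≤ srwI d 1 0 (stepVec ((⟨0, by omega⟩ : Fin d), true) + stepVec ((⟨1, by omega⟩ : Fin d), true) +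
        stepVec ((⟨2, by omega⟩ : Fin d), true)) ∧
      srwI d 1 0 (stepVec ((⟨0, by omega⟩ : Fin d), true) + stepVec ((⟨1, by omega⟩ : Fin d), true) +
        stepVec ((⟨2, by omega⟩ : Fin d), true)) ≤ headTriple d + 750 / (d : ℝ) ^ 6 := by
  have h0 : coordD (stepVec ((⟨0, by omega⟩ : Fin d), true) + stepVec ((⟨1, by omega⟩ : Fin d), true) +
      stepVec ((⟨2, by omega⟩ : Fin d), true)) 0 = 1 := by simp only [coordD_add, coordD_stepVec]; simp
  have h1 : coordD (stepVec ((⟨0, by omega⟩ : Fin d), true) + stepVec ((⟨1, by omega⟩ : Fin d), true) +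
      stepVec ((⟨2, by omega⟩ : Fin d), true)) 1 = 1 := by simp only [coordD_add, coordD_stepVec]; simp
  have h2 : coordD (stepVec ((⟨0, by omega⟩ : Fin d), true) + stepVec ((⟨1, by omega⟩ : Fin d), true) +
      stepVec ((⟨2, by omega⟩ : Fin d), true)) 2 = 1 := by simp only [coordD_add, coordD_stepVec]; simp
  have hz : ∀ i, 3 ≤ i → coordD (stepVec ((⟨0, by omega⟩ : Fin d), true) + stepVec ((⟨1, by omega⟩ : Fin d), true) +
      stepVec ((⟨2, by omega⟩ : Fin d), true)) i = 0 := fun i hi => by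
    have h0' : i ≠ 0 := by omega
    have h1' : i ≠ 1 := by omega
    have h2' : i ≠ 2 := by omega
    simp only [coordD_add, coordD_stepVec]; simp [h0', h1', h2']
  exact ⟨headTriple_le hd h0 h1 h2 hz, le_headTriple_add hd h0 h1 h2 hz⟩

end GreenSymbolic

end Literature.Probability.RandomPlanarGeometry.SAW.Zd.LoopErasure
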